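import Summits.KontsevichZagierPeriods.KontsevichZagierPeriods.Theorems.RootDecompRelativeModAbsoluteEvenCircleP9

/-! # `RootDecompRelativeModAbsoluteEvenCircleP10` — part 10/10 of the mechanical ≤400-line split of `evB_src3.lean` (sha256 9b9fc462830f2800…)
Source: decomp-kz lens-3 g14 EvenCircle.lean FINAL @ba0f3b57 §K0–§K12 (land/EvenCircleB @954ab641, lint-fixed, §K12 re-pointed at the landed CircleSplit names; critic CLEARED g7-2 l.1388: evenCircleCellClose_holds); --supports stmt-KontsevichZagierPeriods-30572.
Split by census-1 g10 `gen/splitlean.py`: scopes re-opened with their `open`/`variable`/`set_option` context; mathematics and declaration order unchanged. -/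

noncomputable section
open Set MeasureTheory
open Literature.NumberTheory.Transcendental Literature.ModelTheory.ExponentialFields
namespace Summit.KontsevichZagierPeriods.RootDecompRelativeModAbsolute.Rung30571.RegularisedLogLayer.CylLog.Leaf.G13
open Set MeasureTheory in
open Literature.NumberTheory.Transcendental Literature.ModelTheory.ExponentialFields in
/-- Auxiliary step `volume_setOf_zero_eq_zero` (§K11): volume set Of zero eq zero. [bookkeeping] -/
private theorem volume_setOf_zero_eq_zero (c : ℝ) : volume {z : Fin 2 → ℝ | z 0 = c} = 0 := by
  rw [volume_pi]
  exact Measure.pi_hyperplane _ _ _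

open Set MeasureTheory in
open Literature.NumberTheory.Transcendental Literature.ModelTheory.ExponentialFields in
/-- Auxiliary step `init_apply_zero` (§B2): init apply zero. [bookkeeping] -/
private theorem init_apply_zero (z : Fin 2 → ℝ) : Fin.init z 0 = z 0 := rfl

namespace AngleFold

/-- **Outer cells.** `EvenCircleCellClose` (over `sqPolyK`/`sqTransK`) for a base cell `E ⊆ {|x| > 1}`: transport all the data along
`x = 1/y` (rule 2 with `Φ(y,θ) = (1/y, θ)`, `|det Φ'| = y⁻²`) to the bounded cell `binv '' E ⊆ (-1,1)` and apply `evenCircle_bdd`. -/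
theorem evenCircle_out (E : Set (Fin 1 → ℝ)) (V : KZ.IntegralRep (1 + 1)) (a₀ : (Fin 1 → ℝ) → ℝ) (q : ℕ)
    (c κ : Fin q → (Fin 1 → ℝ) → ℝ) (M : Fin q → ℕ) (S : ℕ) (f' : Fin S → Fin q → ℤ) (m : Fin S → ℚ)
    (qq' : Fin S → (Fin 1 → ℝ) → ℝ) (hEo : IsOpen E) (hE : IsSemialgebraic ℚ E) (ha₀ : IsSemialgebraicFunOn ℚ E a₀)
    (ha₀I : IntegrableOn a₀ E) (hc : ∀ i, IsSemialgebraicFunOn ℚ E (c i)) (hcs : ∀ i, ContDiffOn ℝ (⊤ : ℕ∞) (c i) E)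
    (hκ : ∀ i, IsSemialgebraicFunOn ℚ E (κ i)) (hκs : ∀ i, ContDiffOn ℝ (⊤ : ℕ∞) (κ i) E) (hM : ∀ i, M i % 2 = 0)
    (hκ0 : ∀ i, ∀ x ∈ E, 0 < κ i x)
    (hI1 : ∀ i, IntegrableOn (fun z : Fin (1 + 1) → ℝ =>
        c i (Fin.init z) * (z (Fin.last 1) ^ M i / (1 + z (Fin.last 1) ^ 2 * κ i (Fin.init z))))
      {z : Fin (1 + 1) → ℝ | Fin.init z ∈ E ∧ z (Fin.last 1) ∈ Set.Ioo 0 1})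
    (hI2 : ∀ i, IntegrableOn (fun x => c i x * ∫ θ in Set.Ioo (0:ℝ) 1, θ ^ M i / (1 + θ ^ 2 * κ i x)) E)
    (hVd : V.domain = {z : Fin (1 + 1) → ℝ | Fin.init z ∈ E ∧ z (Fin.last 1) ∈ Set.Ioo 0 1})
    (hVi : Set.EqOn V.integrand (fun z => a₀ (Fin.init z) +
      ∑ i, c i (Fin.init z) * (z (Fin.last 1) ^ M i / (1 + z (Fin.last 1) ^ 2 * κ i (Fin.init z)))) V.domain)
    (hzero : ∀ x ∈ E, a₀ x + ∑ i, c i x * sqPolyK 0 (M i / 2) (κ i x) = 0)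
    (hqq : ∀ s, IsSemialgebraicFunOn ℚ E (qq' s))
    (hrel : ∀ s, ∀ x ∈ E, ∑ i, (f' s i : ℝ) * Real.arctan (Real.sqrt (κ i x)) = (m s : ℝ) * Real.pi)
    (hbud : ∀ x ∈ E, ∑ s, qq' s x * (m s : ℝ) = 0)
    (hpq : ∀ i, ∀ x ∈ E, c i x * sqTransK 0 (M i / 2) (κ i x) / Real.sqrt (κ i x) = ∑ s, qq' s x * (f' s i : ℝ))
    (hout : E ⊆ {x | 1 < x 0 ^ 2}) :
    KZ.of V ∈ KZ.relations := by
  classical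
  have hE0 : ∀ x ∈ E, x 0 ≠ 0 := fun x hx h => by
    have := hout hx; simp only [mem_setOf_eq, h] at this; norm_num at this
  -- the inverted base cell
  set E' : Set (Fin 1 → ℝ) := {y | binv y ∈ E} with hE'
  have hE'b : ∀ y ∈ E', -1 < y 0 ∧ y 0 < 1 := fun y hy => by
    have h1 : 1 < ((y 0)⁻¹) ^ 2 := hout hy
    rw [inv_pow] at h1
    have ht2 : y 0 ^ 2 < 1 := by
      by_contra h
      push Not at h
      have := inv_le_one_of_one_le₀ h
      linarith
    constructor <;> nlinarith
  have hE'0 : ∀ y ∈ E', y 0 ≠ 0 := fun y hy h => by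
    have h1 : 1 < ((y 0)⁻¹) ^ 2 := hout hy
    rw [h, inv_zero] at h1; norm_num at h1
  have hmaps : MapsTo binv E' E := fun y hy => hy
  have himg : binv '' E = E' := by
    rw [Set.image_eq_preimage_of_inverse binv_invol binv_invol]; rfl
  have himg' : binv '' E' = E := by
    rw [Set.image_eq_preimage_of_inverse binv_invol binv_invol]
    ext x; simp only [mem_preimage, hE', mem_setOf_eq, binv_invol]
  have hE'sa : IsSemialgebraic ℚ E' := by
    rw [← himg]; exact IsSemialgebraicMapOn.isSemialgebraic_image_holds (isSemialgebraicMapOn_binv hE hE0) Subset.rfl hE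
  have hE'o : IsOpen E' := by
    have := continuousOn_binv.isOpen_inter_preimage (isOpen_ne_fun (continuous_apply 0) continuous_const) hEo
    convert this using 1
    ext y; exact ⟨fun hy => ⟨hE'0 y hy, hy⟩, fun hy => hy.2⟩
  have hE'm : MeasurableSet E' := IsSemialgebraic.measurableSet_holds hE'sa
  have hEm : MeasurableSet E := IsSemialgebraic.measurableSet_holds hE
  have hbinv' : IsSemialgebraicMapOn ℚ E' binv := isSemialgebraicMapOn_binv hE'sa hE'0
  have hbb : BddBelow (bpt ⁻¹' E') := ⟨-1, fun t ht => (hE'b _ ht).1.le⟩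
  have hba : BddAbove (bpt ⁻¹' E') := ⟨1, fun t ht => (hE'b _ ht).2.le⟩
  -- the weight `y⁻²`
  have hr : IsSemialgebraicFunOn ℚ E' (fun y => (y 0 ^ 2)⁻¹) :=
    ((Literature.NumberTheory.Transcendental.isSemialgebraicFunOn_apply hE'sa 0).fun_pow 2).inv
      fun y hy => pow_ne_zero _ (hE'0 y hy)
  have hrcd : ContDiffOn ℝ (⊤ : ℕ∞) (fun y : Fin 1 → ℝ => (y 0 ^ 2)⁻¹) E' :=
    (((contDiff_apply ℝ ℝ (0 : Fin 1)).pow 2).contDiffOn).inv fun y hy => pow_ne_zero _ (hE'0 y hy)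
  have hbcd : ContDiffOn ℝ (⊤ : ℕ∞) binv E' :=
    contDiffOn_pi.2 fun _ => ((contDiff_apply ℝ ℝ (0 : Fin 1)).contDiffOn).inv fun y hy => hE'0 y hy
  -- transported data
  have ha₀' : IsSemialgebraicFunOn ℚ E' (fun y => (y 0 ^ 2)⁻¹ * a₀ (binv y)) :=
    hr.mul_holds (IsSemialgebraicFunOn.comp_isSemialgebraicMapOn_holds ha₀ hbinv' hmaps)
  have ha₀I' : IntegrableOn (fun y => (y 0 ^ 2)⁻¹ * a₀ (binv y)) E' :=
    (integrableOn_binv hE'm hE'0 a₀).1 (by rw [himg']; exact ha₀I)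
  have hc' : ∀ i, IsSemialgebraicFunOn ℚ E' (fun y => (y 0 ^ 2)⁻¹ * c i (binv y)) := fun i =>
    hr.mul_holds (IsSemialgebraicFunOn.comp_isSemialgebraicMapOn_holds (hc i) hbinv' hmaps)
  have hcs' : ∀ i, ContDiffOn ℝ (⊤ : ℕ∞) (fun y => (y 0 ^ 2)⁻¹ * c i (binv y)) E' := fun i =>
    hrcd.mul ((hcs i).comp hbcd hmaps)
  have hκ' : ∀ i, IsSemialgebraicFunOn ℚ E' (fun y => κ i (binv y)) := fun i =>
    IsSemialgebraicFunOn.comp_isSemialgebraicMapOn_holds (hκ i) hbinv' hmaps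
  have hκs' : ∀ i, ContDiffOn ℝ (⊤ : ℕ∞) (fun y => κ i (binv y)) E' := fun i => (hκs i).comp hbcd hmaps
  have hκ0' : ∀ i, ∀ y ∈ E', 0 < κ i (binv y) := fun i y hy => hκ0 i _ hy
  have hqq'' : ∀ s, IsSemialgebraicFunOn ℚ E' (fun y => (y 0 ^ 2)⁻¹ * qq' s (binv y)) := fun s =>
    hr.mul_holds (IsSemialgebraicFunOn.comp_isSemialgebraicMapOn_holds (hqq s) hbinv' hmaps)
  -- the transported 2-dimensional rep
  set D' : Set (Fin 2 → ℝ) := {z : Fin (1 + 1) → ℝ | Fin.init z ∈ E' ∧ z (Fin.last 1) ∈ Set.Ioo (0:ℝ) 1} with hD'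
  have hD'sa : IsSemialgebraic ℚ D' := sa_box hE'sa
  have hD'm : MeasurableSet D' := IsSemialgebraic.measurableSet_holds hD'sa
  have hD'0 : ∀ w ∈ D', w 0 ≠ 0 := fun w hw => hE'0 _ hw.1
  have hΦD : MapsTo binv2 D' V.domain := fun w hw => by
    rw [hVd]; exact ⟨by rw [init_binv2]; exact hw.1, by rw [binv2_last]; exact hw.2⟩
  have hΦimg : binv2 '' D' = V.domain := by
    rw [Set.image_eq_preimage_of_inverse binv2_invol binv2_invol, hVd]
    ext z
    simp only [mem_preimage, hD', hE', mem_setOf_eq, init_binv2, binv2_last, binv_invol]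
  have hgi : IntegrableOn (fun w => (w 0 ^ 2)⁻¹ * V.integrand (binv2 w)) D' :=
    (integrableOn_binv2 hD'm hD'0 V.integrand).1 (by rw [hΦimg]; exact V.integrableOn)
  have hgsa : IsSemialgebraicFunOn ℚ D' (fun w => (w 0 ^ 2)⁻¹ * V.integrand (binv2 w)) :=
    (((Literature.NumberTheory.Transcendental.isSemialgebraicFunOn_apply hD'sa 0).fun_pow 2).inv
      (fun w hw => pow_ne_zero _ (hD'0 w hw))).mul_holds
      (IsSemialgebraicFunOn.comp_isSemialgebraicMapOn_holds V.isSemialgebraicFunOn_integrand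
        (isSemialgebraicMapOn_binv2 hD'sa hD'0) hΦD)
  let V' : KZ.IntegralRep 2 := ⟨D', fun w => (w 0 ^ 2)⁻¹ * V.integrand (binv2 w), hD'sa, hgsa, hgi⟩
  -- rule 2 along `Φ = binv2`
  have rΦ : KZ.of V' - KZ.of V ∈ KZ.relations := by
    refine KZ.changeOfVariablesRel_subset_relations ⟨2, V', V, binv2, fun w => flipLin 2 ![-(w 0 ^ 2)⁻¹, 1],
      isSemialgebraicMapOn_binv2 hD'sa hD'0, fun w hw => (hasFDerivAt_binv2 (hD'0 w hw)).hasFDerivWithinAt,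
      fun w₁ _ w₂ _ h => by rw [← binv2_invol w₁, ← binv2_invol w₂]; exact congrArg binv2 h, hΦimg.symm,
      fun w _ => ?_, rfl⟩
    show (w 0 ^ 2)⁻¹ * V.integrand (binv2 w) = V.integrand (binv2 w) * |(flipLin 2 ![-(w 0 ^ 2)⁻¹, 1]).det|
    rw [abs_det_binv2', mul_comm]
  -- the transported hypotheses
  have hI1' : ∀ i, IntegrableOn (fun z : Fin (1 + 1) → ℝ =>
      (fun y : Fin 1 → ℝ => (y 0 ^ 2)⁻¹ * c i (binv y)) (Fin.init z) *
        (z (Fin.last 1) ^ M i / (1 + z (Fin.last 1) ^ 2 * (fun y => κ i (binv y)) (Fin.init z))))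
      {z : Fin (1 + 1) → ℝ | Fin.init z ∈ E' ∧ z (Fin.last 1) ∈ Set.Ioo 0 1} := fun i => by
    have h := hI1 i
    rw [← hVd, ← hΦimg] at h
    refine ((integrableOn_binv2 hD'm hD'0 _).1 h).congr_fun (fun w _ => ?_) hD'm
    simp only [init_binv2, binv2_last, init_apply_zero]
    ring
  have hI2' : ∀ i, IntegrableOn (fun y => (fun y : Fin 1 → ℝ => (y 0 ^ 2)⁻¹ * c i (binv y)) y *
      ∫ θ in Set.Ioo (0:ℝ) 1, θ ^ M i / (1 + θ ^ 2 * (fun y => κ i (binv y)) y)) E' := fun i => by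
    have h := hI2 i
    rw [← himg'] at h
    refine ((integrableOn_binv hE'm hE'0 _).1 h).congr_fun (fun y _ => ?_) hE'm
    simp only []
    ring
  have hVi' : Set.EqOn V'.integrand (fun z => (fun y : Fin 1 → ℝ => (y 0 ^ 2)⁻¹ * a₀ (binv y)) (Fin.init z) +
      ∑ i, (fun y : Fin 1 → ℝ => (y 0 ^ 2)⁻¹ * c i (binv y)) (Fin.init z) *
        (z (Fin.last 1) ^ M i / (1 + z (Fin.last 1) ^ 2 * (fun y => κ i (binv y)) (Fin.init z)))) V'.domain := by
    intro w hw
    show (w 0 ^ 2)⁻¹ * V.integrand (binv2 w) = _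
    rw [hVi (hΦD hw)]
    simp only [init_binv2, binv2_last, init_apply_zero]
    rw [mul_add, Finset.mul_sum]
    refine congrArg _ (Finset.sum_congr rfl fun i _ => by ring)
  have hzero' : ∀ y ∈ E', (fun y : Fin 1 → ℝ => (y 0 ^ 2)⁻¹ * a₀ (binv y)) y +
      ∑ i, (fun y : Fin 1 → ℝ => (y 0 ^ 2)⁻¹ * c i (binv y)) y * sqPolyK 0 (M i / 2) ((fun y => κ i (binv y)) y) = 0 := by
    intro y hy
    have h := hzero (binv y) hy
    simp only []
    calc (y 0 ^ 2)⁻¹ * a₀ (binv y) + ∑ i, (y 0 ^ 2)⁻¹ * c i (binv y) * sqPolyK 0 (M i / 2) (κ i (binv y))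
        = (y 0 ^ 2)⁻¹ * (a₀ (binv y) + ∑ i, c i (binv y) * sqPolyK 0 (M i / 2) (κ i (binv y))) := by
          rw [mul_add, Finset.mul_sum]
          refine congrArg _ (Finset.sum_congr rfl fun i _ => by ring)
      _ = 0 := by rw [h, mul_zero]
  have hrel' : ∀ s, ∀ y ∈ E', ∑ i, (f' s i : ℝ) * Real.arctan (Real.sqrt ((fun y => κ i (binv y)) y)) =
      (m s : ℝ) * Real.pi := fun s y hy => hrel s _ hy
  have hbud' : ∀ y ∈ E', ∑ s, (fun y : Fin 1 → ℝ => (y 0 ^ 2)⁻¹ * qq' s (binv y)) y * (m s : ℝ) = 0 := by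
    intro y hy
    have h := hbud (binv y) hy
    simp only []
    calc ∑ s, (y 0 ^ 2)⁻¹ * qq' s (binv y) * (m s : ℝ) = (y 0 ^ 2)⁻¹ * ∑ s, qq' s (binv y) * (m s : ℝ) := by
          rw [Finset.mul_sum]; exact Finset.sum_congr rfl fun s _ => by ring
      _ = 0 := by rw [h, mul_zero]
  have hpq' : ∀ i, ∀ y ∈ E', (fun y : Fin 1 → ℝ => (y 0 ^ 2)⁻¹ * c i (binv y)) y *
      sqTransK 0 (M i / 2) ((fun y => κ i (binv y)) y) / Real.sqrt ((fun y => κ i (binv y)) y) =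
      ∑ s, (fun y : Fin 1 → ℝ => (y 0 ^ 2)⁻¹ * qq' s (binv y)) y * (f' s i : ℝ) := by
    intro i y hy
    have h := hpq i (binv y) hy
    simp only []
    calc (y 0 ^ 2)⁻¹ * c i (binv y) * sqTransK 0 (M i / 2) (κ i (binv y)) / Real.sqrt (κ i (binv y))
        = (y 0 ^ 2)⁻¹ * (c i (binv y) * sqTransK 0 (M i / 2) (κ i (binv y)) / Real.sqrt (κ i (binv y))) := by ring
      _ = (y 0 ^ 2)⁻¹ * ∑ s, qq' s (binv y) * (f' s i : ℝ) := by rw [h]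
      _ = ∑ s, (y 0 ^ 2)⁻¹ * qq' s (binv y) * (f' s i : ℝ) := by
          rw [Finset.mul_sum]; exact Finset.sum_congr rfl fun s _ => by ring
  have hV' : KZ.of V' ∈ KZ.relations :=
    evenCircle_bdd E' V' (fun y => (y 0 ^ 2)⁻¹ * a₀ (binv y)) q (fun i y => (y 0 ^ 2)⁻¹ * c i (binv y))
      (fun i y => κ i (binv y)) M S f' m (fun s y => (y 0 ^ 2)⁻¹ * qq' s (binv y)) hE'o hE'sa ha₀' ha₀I' hc' hcs'
      hκ' hκs' hM hκ0' hI1' hI2' rfl hVi' hzero' hqq'' hrel' hbud' hpq' hbb hba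
  have := KZ.relations.sub_mem hV' rΦ
  simpa using this

/-- **MAIN THEOREM.** `EvenCircleCellClose`, stated verbatim over the local copies `sqPolyK`/`sqTransK` of `CircleSplit.sqPoly`/`sqTrans`
(identical bodies): cut the base at `x = ±1` (a null set), treat the bounded cell by `evenCircle_bdd` and the two outer cells by
`evenCircle_out`. -/
theorem evenCircleK (E : Set (Fin 1 → ℝ)) (V : KZ.IntegralRep (1 + 1)) (a₀ : (Fin 1 → ℝ) → ℝ) (q : ℕ)
    (c κ : Fin q → (Fin 1 → ℝ) → ℝ) (M : Fin q → ℕ) (S : ℕ) (f' : Fin S → Fin q → ℤ) (m : Fin S → ℚ)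
    (qq' : Fin S → (Fin 1 → ℝ) → ℝ) (hEo : IsOpen E) (hE : IsSemialgebraic ℚ E) (ha₀ : IsSemialgebraicFunOn ℚ E a₀)
    (ha₀I : IntegrableOn a₀ E) (hc : ∀ i, IsSemialgebraicFunOn ℚ E (c i)) (hcs : ∀ i, ContDiffOn ℝ (⊤ : ℕ∞) (c i) E)
    (hκ : ∀ i, IsSemialgebraicFunOn ℚ E (κ i)) (hκs : ∀ i, ContDiffOn ℝ (⊤ : ℕ∞) (κ i) E) (hM : ∀ i, M i % 2 = 0)
    (hκ0 : ∀ i, ∀ x ∈ E, 0 < κ i x)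
    (hI1 : ∀ i, IntegrableOn (fun z : Fin (1 + 1) → ℝ =>
        c i (Fin.init z) * (z (Fin.last 1) ^ M i / (1 + z (Fin.last 1) ^ 2 * κ i (Fin.init z))))
      {z : Fin (1 + 1) → ℝ | Fin.init z ∈ E ∧ z (Fin.last 1) ∈ Set.Ioo 0 1})
    (hI2 : ∀ i, IntegrableOn (fun x => c i x * ∫ θ in Set.Ioo (0:ℝ) 1, θ ^ M i / (1 + θ ^ 2 * κ i x)) E)
    (hVd : V.domain = {z : Fin (1 + 1) → ℝ | Fin.init z ∈ E ∧ z (Fin.last 1) ∈ Set.Ioo 0 1})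
    (hVi : Set.EqOn V.integrand (fun z => a₀ (Fin.init z) +
      ∑ i, c i (Fin.init z) * (z (Fin.last 1) ^ M i / (1 + z (Fin.last 1) ^ 2 * κ i (Fin.init z)))) V.domain)
    (hzero : ∀ x ∈ E, a₀ x + ∑ i, c i x * sqPolyK 0 (M i / 2) (κ i x) = 0)
    (hqq : ∀ s, IsSemialgebraicFunOn ℚ E (qq' s))
    (hrel : ∀ s, ∀ x ∈ E, ∑ i, (f' s i : ℝ) * Real.arctan (Real.sqrt (κ i x)) = (m s : ℝ) * Real.pi)
    (hbud : ∀ x ∈ E, ∑ s, qq' s x * (m s : ℝ) = 0)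
    (hpq : ∀ i, ∀ x ∈ E, c i x * sqTransK 0 (M i / 2) (κ i x) / Real.sqrt (κ i x) = ∑ s, qq' s x * (f' s i : ℝ)) :
    KZ.of V ∈ KZ.relations := by
  classical
  -- every open semialgebraic sub-cell which is bounded or outer closes
  have key : ∀ E₀ : Set (Fin 1 → ℝ), IsOpen E₀ → IsSemialgebraic ℚ E₀ → E₀ ⊆ E →
      ((BddBelow (bpt ⁻¹' E₀) ∧ BddAbove (bpt ⁻¹' E₀)) ∨ E₀ ⊆ {x | 1 < x 0 ^ 2}) →
      ∀ V₀ : KZ.IntegralRep (1 + 1), V₀.domain = {z : Fin (1 + 1) → ℝ | Fin.init z ∈ E₀ ∧ z (Fin.last 1) ∈ Set.Ioo 0 1} →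
        V₀.integrand = V.integrand → KZ.of V₀ ∈ KZ.relations := by
    intro E₀ hE₀o hE₀ hsub hcase V₀ hV₀d hV₀i
    have hbox : V₀.domain ⊆ V.domain := by rw [hV₀d, hVd]; exact fun z hz => ⟨hsub hz.1, hz.2⟩
    have hVi₀ : Set.EqOn V₀.integrand (fun z => a₀ (Fin.init z) +
        ∑ i, c i (Fin.init z) * (z (Fin.last 1) ^ M i / (1 + z (Fin.last 1) ^ 2 * κ i (Fin.init z)))) V₀.domain :=
      fun z hz => by rw [hV₀i]; exact hVi (hbox hz)
    rcases hcase with ⟨hbb, hba⟩ | hout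
    · exact evenCircle_bdd E₀ V₀ a₀ q c κ M S f' m qq' hE₀o hE₀ (ha₀.mono hsub hE₀) (ha₀I.mono_set hsub)
        (fun i => (hc i).mono hsub hE₀) (fun i => (hcs i).mono hsub) (fun i => (hκ i).mono hsub hE₀)
        (fun i => (hκs i).mono hsub) hM (fun i x hx => hκ0 i x (hsub hx))
        (fun i => (hI1 i).mono_set fun z hz => ⟨hsub hz.1, hz.2⟩) (fun i => (hI2 i).mono_set hsub) hV₀d hVi₀
        (fun x hx => hzero x (hsub hx)) (fun s => (hqq s).mono hsub hE₀) (fun s x hx => hrel s x (hsub hx))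
        (fun x hx => hbud x (hsub hx)) (fun i x hx => hpq i x (hsub hx)) hbb hba
    · exact evenCircle_out E₀ V₀ a₀ q c κ M S f' m qq' hE₀o hE₀ (ha₀.mono hsub hE₀) (ha₀I.mono_set hsub)
        (fun i => (hc i).mono hsub hE₀) (fun i => (hcs i).mono hsub) (fun i => (hκ i).mono hsub hE₀)
        (fun i => (hκs i).mono hsub) hM (fun i x hx => hκ0 i x (hsub hx))
        (fun i => (hI1 i).mono_set fun z hz => ⟨hsub hz.1, hz.2⟩) (fun i => (hI2 i).mono_set hsub) hV₀d hVi₀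
        (fun x hx => hzero x (hsub hx)) (fun s => (hqq s).mono hsub hE₀) (fun s x hx => hrel s x (hsub hx))
        (fun x hx => hbud x (hsub hx)) (fun i x hx => hpq i x (hsub hx)) hout
  -- the two cells
  have hx0 : IsSemialgebraicFunOn ℚ E (fun x => x 0) := Literature.NumberTheory.Transcendental.isSemialgebraicFunOn_apply hE 0
  set Ein : Set (Fin 1 → ℝ) := {x | x ∈ E ∧ x 0 ^ 2 < 1} with hEin
  set Eout : Set (Fin 1 → ℝ) := {x | x ∈ E ∧ 1 < x 0 ^ 2} with hEout
  have hEin_sa : IsSemialgebraic ℚ Ein := by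
    have h := (IsSemialgebraicFunOn.sub_holds (hx0.fun_pow 2) (saConst_one hE)).isSemialgebraic_sep_neg
    convert h using 1
    ext x; simp only [hEin, mem_setOf_eq, Pi.sub_apply, sub_neg]
  have hEout_sa : IsSemialgebraic ℚ Eout := by
    have h := (IsSemialgebraicFunOn.sub_holds (saConst_one hE) (hx0.fun_pow 2)).isSemialgebraic_sep_neg
    convert h using 1
    ext x; simp only [hEout, mem_setOf_eq, Pi.sub_apply, sub_neg]
  have hc0 : Continuous fun x : Fin 1 → ℝ => x 0 ^ 2 := (continuous_apply 0).pow 2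
  have hEin_o : IsOpen Ein := hEo.inter (isOpen_lt hc0 continuous_const)
  have hEout_o : IsOpen Eout := hEo.inter (isOpen_lt continuous_const hc0)
  have hEin_b : ∀ t ∈ bpt ⁻¹' Ein, -1 < t ∧ t < 1 := fun t ht => by
    have h : t ^ 2 < 1 := ht.2
    constructor <;> nlinarith
  set Din : Set (Fin 2 → ℝ) := {z : Fin (1 + 1) → ℝ | Fin.init z ∈ Ein ∧ z (Fin.last 1) ∈ Set.Ioo (0:ℝ) 1} with hDin
  set Dout : Set (Fin 2 → ℝ) := {z : Fin (1 + 1) → ℝ | Fin.init z ∈ Eout ∧ z (Fin.last 1) ∈ Set.Ioo (0:ℝ) 1} with hDout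
  have hDinV : Din ⊆ V.domain := fun z hz => by rw [hVd]; exact ⟨hz.1.1, hz.2⟩
  have hDoutV : Dout ⊆ V.domain := fun z hz => by rw [hVd]; exact ⟨hz.1.1, hz.2⟩
  let Vin : KZ.IntegralRep 2 := V.restrict Din (sa_box hEin_sa) hDinV
  let Vout : KZ.IntegralRep 2 := V.restrict Dout (sa_box hEout_sa) hDoutV
  have rin : KZ.of Vin ∈ KZ.relations := key Ein hEin_o hEin_sa (fun x hx => hx.1)
    (Or.inl ⟨⟨-1, fun t ht => (hEin_b t ht).1.le⟩, ⟨1, fun t ht => (hEin_b t ht).2.le⟩⟩) Vin rfl rfl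
  have rout : KZ.of Vout ∈ KZ.relations := key Eout hEout_o hEout_sa (fun x hx => hx.1)
    (Or.inr fun x hx => hx.2) Vout rfl rfl
  -- a.e. cover
  have hdisj : Din ∩ Dout = ∅ := by
    ext z
    simp only [mem_inter_iff, hDin, hDout, hEin, hEout, mem_setOf_eq, mem_empty_iff_false, iff_false]
    rintro ⟨⟨⟨_, h1⟩, _⟩, ⟨⟨_, h2⟩, _⟩⟩
    linarith
  have hcov : KZ.of V - ∑ i, KZ.of (![Vin, Vout] i) ∈ KZ.relations := by
    refine KZ.of_sub_sum_of_mem_relations (Finset.univ : Finset (Fin 2)) V ![Vin, Vout] ?_ ?_ ?_ ?_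
    · intro i _
      fin_cases i
      · show volume (Din \ V.domain) = 0
        rw [Set.sdiff_eq_empty.2 hDinV]; exact measure_empty
      · show volume (Dout \ V.domain) = 0
        rw [Set.sdiff_eq_empty.2 hDoutV]; exact measure_empty
    · intro i _
      fin_cases i <;> exact fun _ _ => rfl
    · refine measure_mono_null (fun z hz => ?_)
        (measure_union_null (volume_setOf_zero_eq_zero 1) (volume_setOf_zero_eq_zero (-1)))
      obtain ⟨hzV, hnot⟩ := hz
      rw [hVd] at hzV
      obtain ⟨hxE, hθ⟩ := hzV
      have h1 : ¬ (z 0 ^ 2 < 1) := fun h =>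
        hnot (Set.mem_iUnion₂.2 ⟨(0 : Fin 2), Finset.mem_univ _, show z ∈ Din from ⟨⟨hxE, h⟩, hθ⟩⟩)
      have h2 : ¬ (1 < z 0 ^ 2) := fun h =>
        hnot (Set.mem_iUnion₂.2 ⟨(1 : Fin 2), Finset.mem_univ _, show z ∈ Dout from ⟨⟨hxE, h⟩, hθ⟩⟩)
      have hsq : z 0 ^ 2 = 1 := le_antisymm (not_lt.1 h2) (not_lt.1 h1)
      have hm : (z 0 - 1) * (z 0 + 1) = 0 := by linear_combination hsq
      rcases mul_eq_zero.1 hm with h | h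
      · exact Or.inl (show z 0 = 1 by linarith)
      · exact Or.inr (show z 0 = -1 by linarith)
    · intro i _ j _ hij
      fin_cases i <;> fin_cases j
      · exact absurd rfl hij
      · show volume (Din ∩ Dout) = 0
        rw [hdisj]; exact measure_empty
      · show volume (Dout ∩ Din) = 0
        rw [inter_comm, hdisj]; exact measure_empty
      · exact absurd rfl hij
  have hsum : ∑ i, KZ.of (![Vin, Vout] i) = KZ.of Vin + KZ.of Vout := by
    rw [Fin.sum_univ_two]; rfl
  rw [hsum] at hcov
  have := KZ.relations.add_mem hcov (KZ.relations.add_mem rin rout)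
  simpa using this

end AngleFold

/-! ### §K12 BRIDGE to the residual: `sqPolyK = sqPoly`, `sqTransK = sqTrans` (the landed `…CircleSplitP01` tables) and
`evenCircleCellClose_holds : EvenCircleCellClose` — the residual of `…CircleSplitP08` §26, PROVED. -/

/-- Auxiliary step `sqPolyK_eq` (§K12): sq Poly K eq. [bookkeeping] -/
theorem AngleFold.sqPolyK_eq : @AngleFold.sqPolyK = @sqPoly := by
  funext r j κ
  induction j with
  | zero => rfl
  | succ j ih => simp only [AngleFold.sqPolyK, sqPoly, ih]

/-- Auxiliary step `sqTransK_eq` (§K12): sq Trans K eq. [bookkeeping] -/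
theorem AngleFold.sqTransK_eq : @AngleFold.sqTransK = @sqTrans := by
  funext r j κ
  induction j with
  | zero => rfl
  | succ j ih => simp only [AngleFold.sqTransK, sqTrans, ih]

/-- **THE RESIDUAL `EvenCircleCellClose` (…CircleSplitP08 §26), PROVED.** With `cylKernelZeroCirclePos_of_log_and_evenCircle` (…CircleSplitP11 §27) and the tree theorems `cylKernelZeroLog_of_trees` (P45) / `regKernelPairDegOne_iff_circlePos_of_trees` (P48) this closes item 30572 `RegKernelPairDegOne` modulo `LogStructure` + `BoundaryRigidity` by name. -/
theorem evenCircleCellClose_holds : EvenCircleCellClose := by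
  intro E V a₀ q c κ M S f' m qq' hEo hE ha₀ ha₀I hc hcs hκ hκs hM hκ0 hI1 hI2 hVd hVi hzero hqq hrel hbud hpq
  rw [← AngleFold.sqPolyK_eq] at hzero
  rw [← AngleFold.sqTransK_eq] at hpq
  exact AngleFold.evenCircleK E V a₀ q c κ M S f' m qq' hEo hE ha₀ ha₀I hc hcs hκ hκs hM hκ0 hI1 hI2 hVd hVi hzero hqq
    hrel hbud hpq

end Summit.KontsevichZagierPeriods.RootDecompRelativeModAbsolute.Rung30571.RegularisedLogLayer.CylLog.Leaf.G13

end
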